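import Mathlib
import Summits.KontsevichZagierPeriods.Zeta5Search.SorokinCensus.RawLocusOddProof
import HarnessLib

/-!
# Balanced rays are stably odd (generalized Sorokin family `J₅^gen`)

HONEST FRAMING: systematic search; no irrationality claim unless certified.

FAMILY.md §17d, §17h (fam-sorokin gen 5). The BALANCED-POLE predicate, the eight convergence inequalities and
admissibility are all invariant under the ray map `p ↦ n • p` (`GenPoint.smul`, `n ≥ 1`): they are (strict or
non-strict) *homogeneous* linear inequalities in the fifteen exponents (the two `max` terms of `Balanced` scale because
`n ≥ 0`). Consequently the gen-5 theorem BALANCED ⇒ ODD (`balancedOdd_of`, modulo the criterion node and Zudilin's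
very-well-poised identity `vwp_eq_integral_of_pos`) upgrades for free to

  BALANCED ⇒ STABLY ODD:  `J(n • p) ∈ ℚ + ℚζ(3) + ℚζ(5)` for every `n ≥ 1`

(`balancedRaysOdd_of`, and the integrability-hypothesis form `balancedRaysOdd_of_vwp` modulo Zudilin's identity alone).
This is the PROVED half of the census dichotomy behind CONJECTURE B (`UnbalancedZeta5RaysLeaveIntegrable`: an
unbalanced, not-lower-weight point has a ray that LEAVES `ℚ + ℚζ(3) + ℚζ(5)`; census-exact on > 10⁷ points, not a tree
target): for points that are not of lower weight, "the ray stays odd" is conjecturally EQUIVALENT to "balanced", and the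
implication ⇐ is the present file.
-/

namespace Summit.KontsevichZagierPeriods.Zeta5Search.SorokinCensus

open Literature.NumberTheory.Irrationality Literature.NumberTheory.Irrationality.Zudilin2002

namespace GenPoint

/-- `(n • p).a₀ = n a₀`. -/
@[simp] theorem smul_a₀ (n : ℕ) (p : GenPoint) : (p.smul n).a₀ = n * p.a₀ := rfl

/-- `(n • p).a_j = n a_j`. -/
@[simp] theorem smul_a (n : ℕ) (p : GenPoint) (j : Fin 5) : (p.smul n).a j = n * p.a j := rfl

/-- `(n • p).b_j = n b_j`. -/
@[simp] theorem smul_b (n : ℕ) (p : GenPoint) (j : Fin 5) : (p.smul n).b j = n * p.b j := rfl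

/-- `(n • p).e_j = n e_j`. -/
@[simp] theorem smul_e (n : ℕ) (p : GenPoint) (j : Fin 5) : (p.smul n).e j = n * p.e j := rfl

/-- `(n • p).c_j = n c_j`. -/
@[simp] theorem smul_c (n : ℕ) (p : GenPoint) (j : Fin 5) : (p.smul n).c j = n * p.c j := by
  simp [c, smul, mul_sub]

/-- Admissibility `1 ≤ a_j < b_j` is preserved along rays (`n ≥ 1`). -/
theorem smul_admissible {p : GenPoint} {n : ℕ} (hn : 1 ≤ n) (h : p.Admissible) : (p.smul n).Admissible := by
  have hn' : (1 : ℤ) ≤ n := by exact_mod_cast hn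
  intro j
  obtain ⟨h1, h2⟩ := h j
  refine ⟨?_, ?_⟩
  · rw [smul_a]; nlinarith
  · rw [smul_a, smul_b]; nlinarith

/-- The eight strict convergence inequalities are homogeneous, hence preserved along rays (`n ≥ 1`). -/
theorem smul_converges {p : GenPoint} {n : ℕ} (hn : 1 ≤ n) (h : p.Converges) : (p.smul n).Converges := by
  have hn' : (0 : ℤ) < n := by exact_mod_cast hn
  obtain ⟨h1, h2, h3, h4, h5, h6, h7, h8⟩ := h
  unfold Converges
  simp only [smul_c, smul_a, smul_a₀, smul_e]
  refine ⟨?_, ?_, ?_, ?_, ?_, ?_, ?_, ?_⟩ <;> nlinarith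

/-- The BALANCED-POLE predicate is homogeneous (the `max` terms scale for `n ≥ 0`), hence preserved along rays. -/
theorem smul_balanced {p : GenPoint} (n : ℕ) (h : p.Balanced) : (p.smul n).Balanced := by
  have hn' : (0 : ℤ) ≤ n := by exact_mod_cast Nat.zero_le n
  obtain ⟨h1, h2, h3, h4, h5, h6⟩ := h
  unfold Balanced
  simp only [smul_c, smul_a, smul_b, smul_a₀, smul_e]
  refine ⟨?_, ?_, ?_, ?_, ?_, ?_⟩
  · nlinarith
  · nlinarith
  · nlinarith
  · nlinarith
  · have key : (n : ℤ) * p.e 2 ≤ n * max 0 (p.c 0 - p.a₀) := mul_le_mul_of_nonneg_left h5 hn'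
    rw [mul_max_of_nonneg _ _ hn', mul_zero, mul_sub] at key
    exact key
  · have key : (n : ℤ) * (p.b 1 + p.e 2) ≤ n * (p.c 2 + max (p.a 3) (p.c 4)) :=
      mul_le_mul_of_nonneg_left h6 hn'
    rw [mul_add, mul_add, mul_max_of_nonneg _ _ hn'] at key
    exact key

/-- `a₀ ≥ 1` is preserved along rays (`n ≥ 1`). -/
theorem smul_a₀_pos {p : GenPoint} {n : ℕ} (hn : 1 ≤ n) (h : 1 ≤ p.a₀) : 1 ≤ (p.smul n).a₀ := by
  have hn' : (1 : ℤ) ≤ n := by exact_mod_cast hn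
  rw [smul_a₀]; nlinarith

end GenPoint

open GenPoint

/-- **BALANCED RAYS ARE STABLY ODD** (modulo the criterion node and Zudilin's very-well-poised identity): for every
balanced admissible convergent integer point `p` with `a₀ ≥ 1`, EVERY point `n • p` (`n ≥ 1`) of its ray has
`J(n • p) ∈ ℚ + ℚζ(3) + ℚζ(5)`. One line from `balancedOdd_of` and the homogeneity lemmas above. -/
theorem balancedRaysOdd_of (hC : ConvergenceCriterion) (h4 : vwp_eq_integral_of_pos) :
    ∀ p : GenPoint, p.Admissible → p.Converges → 1 ≤ p.a₀ → p.Balanced → ∀ n ≥ 1, (p.smul n).Odd :=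
  fun _ hadm hconv ha₀ hbal n hn =>
    balancedOdd_of hC h4 _ (smul_admissible hn hadm) (smul_converges hn hconv) (smul_a₀_pos hn ha₀)
      (smul_balanced n hbal)

/-- The same modulo Zudilin's identity ALONE, with integrability of the ray points as a hypothesis (supplied by
the criterion node `ConvergenceCriterion`, itself reduced to Fischler's printed finiteness criterion in
`ConvergenceCriterionProof`). -/
theorem balancedRaysOdd_of_vwp (h4 : vwp_eq_integral_of_pos) :
    ∀ p : GenPoint, p.Admissible → p.Converges → 1 ≤ p.a₀ → p.Balanced →
      ∀ n ≥ 1, (p.smul n).Integrable → (p.smul n).Odd :=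
  fun _ hadm hconv ha₀ hbal n hn hint =>
    balancedOddIntegrable_of_vwp h4 _ (smul_admissible hn hadm) (smul_converges hn hconv) hint
      (smul_a₀_pos hn ha₀) (smul_balanced n hbal)

/-- Corollary in the language of CONJECTURE B's node: for a balanced admissible convergent point the ray hypothesis
`∀ n ≥ 1, (n • p).Odd` of `UnbalancedZeta5RaysLeave(Integrable)` HOLDS (mod the two inputs) — so in that node the
hypothesis `¬ p.Balanced` carries all the content: the dichotomy "ray stays in `ℚ + ℚζ(3) + ℚζ(5)` ⟺ balanced" (for points
not of lower weight) has its ⇐ half proved here and its ⇒ half census-exact only. -/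
theorem raysOdd_iff_balanced_provedHalf (hC : ConvergenceCriterion) (h4 : vwp_eq_integral_of_pos) (p : GenPoint)
    (hadm : p.Admissible) (hconv : p.Converges) (ha₀ : 1 ≤ p.a₀) :
    p.Balanced → ∀ n ≥ 1, (p.smul n).Odd :=
  balancedRaysOdd_of hC h4 p hadm hconv ha₀

end Summit.KontsevichZagierPeriods.Zeta5Search.SorokinCensus
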